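/-
Copyright (c) 2026 the pub-hodgecm-mathlib formalisation cell (harness21).  Prover seat hodgecm-mathlib-LH4-p04 (g8), req620 Track A «(D-RAM) FOUR-FRAME» squad
(STAGE-1b, row (2) of the piece `f_{T₊}`, the (β₂) road; dealer∕pen LH4-plan (g13) WORD #108 (4) ∕ WORD #112 (1): «(S4) β₂ ASSEMBLY», LH4-p04 lineage; brick (S4-seam)), 2026-09-04.
-/
import Summits.HodgeConjecture.HodgeConjecture.Theorems.F0P3cDyRamCleanSgnModelForm                -- ★ (LH4-p05 (g8)): `cleanMinusFixCount_conj_eq`; brings ★ p859223 `transvPlusFixCount_conj_eq`, ★ DEFS №5 `cleanMinusFixCount`, ★ U2G `transvPlusFixCount`, `LatticeLabelPlus`, `latticeValueSetMod`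
import Summits.HodgeConjecture.HodgeConjecture.Theorems.F0P3cDyRamFixedPointCensusTypeTwoPrelude  -- ★ p857439: `antidiagonal_three_over_eq_block_antidiagonal_two` (`Φ₃ = block(Φ₂, 1)` on the nose)
import HarnessLib

/-!
# Crux `H413`, line LH4 «(D-RAM) FOUR-FRAME» — STAGE-1b, row (2), the (β₂) road, brick (S4-seam): «THE LABELLED FIX-COUNTS `T₊`, `T−′` AT THE TWO LITERAL SHAPES, READ AS
# BLOCK-MODEL CENSUSES» — the lattice-to-block seam between `beta2Models.letter.v1` and ★ p861044 ∕ p861072's labelled order forms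

Cell `hodgecm-mathlib` (D-0151), FLOOR 0, crux item H413 = `stmt-HodgeConjecture-24833`, route of record `HCCMUnconditional`; squad F0∕P3c∕LH4; lane
`--supports stmt-HodgeConjecture-24833 --as helper` (count-neutral; pays NO tier-0 row).  THEOREMS ONLY (no `def`, no instance, no notation, no `sorry`, default heartbeats).
DATUM-FREE (`K` a valued field, `σ : K →+* K`, any `ϖ d ℓ m mc`).

WHY.  The producers' socket of the (β₂) road (`beta2Models.letter.v1` 46d52237; chain ★-cand `hbeta2Frame_of_models` → ★-cand `hbeta2lit_of_frame` → ★ p860931 `hbeta2_of_literals`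
→ tier-0 `stub_law_cleanSgn₂`) concludes, in LATTICE currency, `(T₊ − T−′)(endoGL (γ₂, u)) = (T₊ − T−′)(P₁·endoGL (γ₁, u)·P₁⁻¹)` with `T₊ = transvPlusFixCount σ ϖ d ℓ m`,
`T−′ = cleanMinusFixCount σ ϖ d ℓ m m_c` (★ census DEFS: type-0 vertices of `(K³, Φ₃)`, `Φ₃ = (StdForm.antidiagonal 3).over K`).  The tools that EVALUATE them — ★ p860968
`…BlockGlueLabelledCount`, ★ p861044 `…BlockCensusOrderFormLabelled`, ★-cand `…WSideOrderCensusLabelled`, ★ p861015 `…BlockGlueLabelFibreConstant` — count `{M ∣ IsSelfDualLattice σ ϖ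
(block(H₂, h_W)) M ∧ (endoGL (γ, u)·M = M ∧ Q M)}` for a BLOCK form and a side condition `Q` (the shell ∧ the class of the `H`-value set `{⟨y, (Γ − 1)y⟩_H}` thickened by `ϖ^m`).
THIS FILE is the seam, in exactly those letters:
* §1 HYPERBOLIC SHAPE — `Φ₃` IS `block(Φ₂, 1)` (`Φ₂ = (StdForm.antidiagonal 2).over K`, ★ Prelude `antidiagonal_three_over_eq_block_antidiagonal_two`): `transvPlusFixCount σ ϖ d ℓ m Γ`
  and `cleanMinusFixCount σ ϖ d ℓ m mc Γ` EQUAL the block censuses of `(block(Φ₂, 1), Γ)` at `Q := shell(ℓ, m) ∧ {value set} = valueSetMod σ ϖ m (xPlus σ ϖ d)` resp.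
  `Q := shell(ℓ, mc) ∧ ¬ …` — for ANY `Γ : GL₃(K)` (`transvPlusFixCount_eq_ncard_block`, `cleanMinusFixCount_eq_ncard_block`; definitional after the one rewrite).
* §2 ANISOTROPIC SHAPE — for `formCongr σ P₁ Φ₃ = block(diag dg, η)`: `transvPlusFixCount σ ϖ d ℓ m (P₁·T·P₁⁻¹)` and `cleanMinusFixCount … (P₁·T·P₁⁻¹)` EQUAL the block censuses of
  `(block(diag dg, η), T)` (★ p859223 `transvPlusFixCount_conj_eq` ∕ ★ `cleanMinusFixCount_conj_eq` at that model — restated in the `IsSelfDualLattice` ∕ `∧`-nesting of ★ p861044's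
  HEAD so that it applies by `rw` with no reshuffling: `transvPlusFixCount_conj_eq_ncard_block`, `cleanMinusFixCount_conj_eq_ncard_block`).
* §3 `formCongr_placeForm_eq_iff` is not needed: at the CM place `placeForm Φ₃ w.1 = (StdForm.antidiagonal 3).over L_w` is ★ `placeForm_antidiagOne` (one `rw` for the consumer).
HONEST LABEL.  Count-neutral bookkeeping (two rewrites and two restatements); nothing printed is asserted; (β₂) and its letters stay HYPOTHESES; `HC_CM` is proved only modulo the
7 printed citations (2 remaining named inputs: hLiu418 = `stmt-HodgeConjecture-24832`, h413 = `stmt-HodgeConjecture-24833`) until rung 0 closes.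
## References
* [Rogawski1990] J. D. Rogawski, *Automorphic Representations of Unitary Groups in Three Variables*, Ann. of Math. Stud. 123 (1990): §4.9 Prop. 4.9.1 (b) p. 55.
* [Kottwitz1986BaseChangeUnits] R. E. Kottwitz, *Base change for unit elements of Hecke algebras*, Compositio Math. 60 (1986): §1 pp. 240–241.
* [Jacobowitz1962] R. Jacobowitz, *Hermitian forms over local fields*, Amer. J. Math. 84 (1962): §4.
-/

set_option autoImplicit false

noncomputable section

namespace Summit.HodgeConjecture.HodgeConjecture.Cruxes.H413.F0P3cDyRamLabelledFixCountBlockSeam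

open scoped Valued WithZero Matrix MatrixGroups
open Literature.NumberTheory.Automorphic Literature.NumberTheory.Automorphic.HermitianLattice Literature.NumberTheory.Automorphic.UnitaryLatticeTree
open Literature.NumberTheory.Rogawski1990
open Literature.NumberTheory.Automorphic.UnitaryThreeFourFrame
open Summit.HodgeConjecture.HodgeConjecture.Cruxes.H413.F0P3cDyRamFourFramePieces
open Summit.HodgeConjecture.HodgeConjecture.Cruxes.H413.F0P3cDyRamFourFrameCensusDefs
open Summit.HodgeConjecture.HodgeConjecture.Cruxes.H413.F0P3cDyRamStageOneBDefs
open Summit.HodgeConjecture.HodgeConjecture.Cruxes.H413.F0P3cDyRamLabelCountDiagonalModel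
open Summit.HodgeConjecture.HodgeConjecture.Cruxes.H413.F0P3cDyRamCleanSgnModelForm
open Summit.HodgeConjecture.HodgeConjecture.Cruxes.H413.F0P3cDyRamFixedPointCensusTypeTwoPrelude

variable {K : Type} [Field K] [Valued K ℤᵐ⁰]

/-! ## §1 Hyperbolic shape: `Φ₃ = block(Φ₂, 1)` on the nose -/

/-- **`T₊` AS A BLOCK CENSUS OF `(block(Φ₂, 1), Γ)`** — `transvPlusFixCount σ ϖ d ℓ m Γ = #{M ∣ SD for block(Φ₂, 1), Γ·M = M, shell(ℓ, m)(Γ − 1), {⟨y, (Γ − 1)y⟩_{block(Φ₂,1)}}_m = V₊}`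
for ANY `Γ`, in ★ p861044's `{M ∣ SD ∧ (fix ∧ Q M)}` shape (`Φ₂ = (StdForm.antidiagonal 2).over K`; ★ Prelude `antidiagonal_three_over_eq_block_antidiagonal_two`, then the goal closes by `rfl` inside `rw`).
[cite: Rogawski1990, §4.9 Prop. 4.9.1 (b) p. 55] [cite: Kottwitz1986BaseChangeUnits, §1 pp. 240–241] -/
theorem transvPlusFixCount_eq_ncard_block (σ : K →+* K) (ϖ : K) (d ℓ m : ℕ) (Γ : GL (Fin 3) K) :
    transvPlusFixCount σ ϖ d ℓ m Γ =
      {M : Submodule 𝒪[K] (Fin 3 → K) |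
        IsSelfDualLattice σ ϖ (!![((StdForm.antidiagonal 2).over K) 0 0, 0, ((StdForm.antidiagonal 2).over K) 0 1; 0, (1 : K), 0;
            ((StdForm.antidiagonal 2).over K) 1 0, 0, ((StdForm.antidiagonal 2).over K) 1 1] : Matrix (Fin 3) (Fin 3) K) M ∧
          (mapGL Γ M = M ∧
            (LatticeNearTransvShell ϖ ℓ m ((Γ : Matrix (Fin 3) (Fin 3) K) - 1) M ∧
              {z : K | ∃ y ∈ M, Valued.v ((ϖ ^ m)⁻¹ * (z - pairing σ (!![((StdForm.antidiagonal 2).over K) 0 0, 0, ((StdForm.antidiagonal 2).over K) 0 1; 0, (1 : K), 0;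
                  ((StdForm.antidiagonal 2).over K) 1 0, 0, ((StdForm.antidiagonal 2).over K) 1 1] : Matrix (Fin 3) (Fin 3) K) y (((Γ : Matrix (Fin 3) (Fin 3) K) - 1) *ᵥ y))) ≤ 1} =
                valueSetMod σ ϖ m (xPlus σ ϖ d)))}.ncard := by
  unfold transvPlusFixCount LatticeLabelPlus latticeValueSetMod
  rw [antidiagonal_three_over_eq_block_antidiagonal_two]

/-- **`T−′` AS A BLOCK CENSUS OF `(block(Φ₂, 1), Γ)`** — `cleanMinusFixCount σ ϖ d ℓ m mc Γ = #{M ∣ SD for block(Φ₂, 1), Γ·M = M, shell(ℓ, mc)(Γ − 1), ¬ {⟨y, (Γ − 1)y⟩}_m = V₊}`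
for ANY `Γ`, in ★ p861044's shape. [cite: Rogawski1990, §4.9 Prop. 4.9.1 (b) p. 55] [cite: Kottwitz1986BaseChangeUnits, §1 pp. 240–241] -/
theorem cleanMinusFixCount_eq_ncard_block (σ : K →+* K) (ϖ : K) (d ℓ m mc : ℕ) (Γ : GL (Fin 3) K) :
    cleanMinusFixCount σ ϖ d ℓ m mc Γ =
      {M : Submodule 𝒪[K] (Fin 3 → K) |
        IsSelfDualLattice σ ϖ (!![((StdForm.antidiagonal 2).over K) 0 0, 0, ((StdForm.antidiagonal 2).over K) 0 1; 0, (1 : K), 0;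
            ((StdForm.antidiagonal 2).over K) 1 0, 0, ((StdForm.antidiagonal 2).over K) 1 1] : Matrix (Fin 3) (Fin 3) K) M ∧
          (mapGL Γ M = M ∧
            (LatticeNearTransvShell ϖ ℓ mc ((Γ : Matrix (Fin 3) (Fin 3) K) - 1) M ∧
              ¬ {z : K | ∃ y ∈ M, Valued.v ((ϖ ^ m)⁻¹ * (z - pairing σ (!![((StdForm.antidiagonal 2).over K) 0 0, 0, ((StdForm.antidiagonal 2).over K) 0 1; 0, (1 : K), 0;
                  ((StdForm.antidiagonal 2).over K) 1 0, 0, ((StdForm.antidiagonal 2).over K) 1 1] : Matrix (Fin 3) (Fin 3) K) y (((Γ : Matrix (Fin 3) (Fin 3) K) - 1) *ᵥ y))) ≤ 1} =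
                valueSetMod σ ϖ m (xPlus σ ϖ d)))}.ncard := by
  unfold cleanMinusFixCount LatticeLabelPlus latticeValueSetMod
  rw [antidiagonal_three_over_eq_block_antidiagonal_two]

/-! ## §2 Anisotropic shape: the model `formCongr σ P₁ Φ₃ = block(diag dg, η)` -/

/-- **`T₊` OF `P₁·T·P₁⁻¹` AS A BLOCK CENSUS OF `(block(diag dg, η), T)`** — ★ p859223 `transvPlusFixCount_conj_eq` at the model `block(diag dg, η)`, restated in ★ p861044's
`{M ∣ SD ∧ (fix ∧ Q M)}` shape. [cite: Rogawski1990, §4.9 Prop. 4.9.1 (b) p. 55] [cite: Kottwitz1986BaseChangeUnits, §1 pp. 240–241] [cite: Jacobowitz1962, §4] -/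
theorem transvPlusFixCount_conj_eq_ncard_block (σ : K →+* K) (ϖ : K) {dg : Fin 2 → K} {η : K} {P₁ T : GL (Fin 3) K}
    (hA : formCongr σ P₁ ((StdForm.antidiagonal 3).over K) =
      (!![(Matrix.diagonal dg) 0 0, 0, (Matrix.diagonal dg) 0 1; 0, η, 0; (Matrix.diagonal dg) 1 0, 0, (Matrix.diagonal dg) 1 1] : Matrix (Fin 3) (Fin 3) K)) (d ℓ m : ℕ) :
    transvPlusFixCount σ ϖ d ℓ m (P₁ * T * P₁⁻¹) =
      {M : Submodule 𝒪[K] (Fin 3 → K) |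
        IsSelfDualLattice σ ϖ (!![(Matrix.diagonal dg) 0 0, 0, (Matrix.diagonal dg) 0 1; 0, η, 0; (Matrix.diagonal dg) 1 0, 0, (Matrix.diagonal dg) 1 1] : Matrix (Fin 3) (Fin 3) K) M ∧
          (mapGL T M = M ∧
            (LatticeNearTransvShell ϖ ℓ m ((T : Matrix (Fin 3) (Fin 3) K) - 1) M ∧
              {z : K | ∃ y ∈ M, Valued.v ((ϖ ^ m)⁻¹ * (z - pairing σ (!![(Matrix.diagonal dg) 0 0, 0, (Matrix.diagonal dg) 0 1; 0, η, 0; (Matrix.diagonal dg) 1 0, 0, (Matrix.diagonal dg) 1 1] : Matrix (Fin 3) (Fin 3) K) y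
                  (((T : Matrix (Fin 3) (Fin 3) K) - 1) *ᵥ y))) ≤ 1} = valueSetMod σ ϖ m (xPlus σ ϖ d)))}.ncard :=
  transvPlusFixCount_conj_eq σ ϖ hA rfl d ℓ m

/-- **`T−′` OF `P₁·T·P₁⁻¹` AS A BLOCK CENSUS OF `(block(diag dg, η), T)`** — ★ `cleanMinusFixCount_conj_eq` at the model `block(diag dg, η)`, in ★ p861044's shape.
[cite: Rogawski1990, §4.9 Prop. 4.9.1 (b) p. 55] [cite: Kottwitz1986BaseChangeUnits, §1 pp. 240–241] [cite: Jacobowitz1962, §4] -/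
theorem cleanMinusFixCount_conj_eq_ncard_block (σ : K →+* K) (ϖ : K) {dg : Fin 2 → K} {η : K} {P₁ T : GL (Fin 3) K}
    (hA : formCongr σ P₁ ((StdForm.antidiagonal 3).over K) =
      (!![(Matrix.diagonal dg) 0 0, 0, (Matrix.diagonal dg) 0 1; 0, η, 0; (Matrix.diagonal dg) 1 0, 0, (Matrix.diagonal dg) 1 1] : Matrix (Fin 3) (Fin 3) K)) (d ℓ m mc : ℕ) :
    cleanMinusFixCount σ ϖ d ℓ m mc (P₁ * T * P₁⁻¹) =
      {M : Submodule 𝒪[K] (Fin 3 → K) |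
        IsSelfDualLattice σ ϖ (!![(Matrix.diagonal dg) 0 0, 0, (Matrix.diagonal dg) 0 1; 0, η, 0; (Matrix.diagonal dg) 1 0, 0, (Matrix.diagonal dg) 1 1] : Matrix (Fin 3) (Fin 3) K) M ∧
          (mapGL T M = M ∧
            (LatticeNearTransvShell ϖ ℓ mc ((T : Matrix (Fin 3) (Fin 3) K) - 1) M ∧
              ¬ {z : K | ∃ y ∈ M, Valued.v ((ϖ ^ m)⁻¹ * (z - pairing σ (!![(Matrix.diagonal dg) 0 0, 0, (Matrix.diagonal dg) 0 1; 0, η, 0; (Matrix.diagonal dg) 1 0, 0, (Matrix.diagonal dg) 1 1] : Matrix (Fin 3) (Fin 3) K) y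
                  (((T : Matrix (Fin 3) (Fin 3) K) - 1) *ᵥ y))) ≤ 1} = valueSetMod σ ϖ m (xPlus σ ϖ d)))}.ncard :=
  cleanMinusFixCount_conj_eq σ ϖ hA rfl d ℓ m mc

end Summit.HodgeConjecture.HodgeConjecture.Cruxes.H413.F0P3cDyRamLabelledFixCountBlockSeam

end
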